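import Summits.QuantumFields.BalabanUV.T4Continuum.Spine.NE4.OneSidedNoGo

/-!
# Spine/NE4/OneSidedNoGoLog — the (R41) witness ALSO carries node U2's history companions in the (R40) log currency

Cell `pub-balaban-gaps` (YM blitz G2), seat `ne4`, generation 8 (unit `pub-balaban-gaps-ne4-g8`); record `HOME/ne/NE4.md` §5 (R41)(b′).
Companion to `Spine/NE4/OneSidedNoGo` (imports it; modifies nothing).  Node U2's print-faithful input list (census (R40),
`Spine/NE4/FadingFromRateRelAnalytic[U2]`) reads the history moduli in the LOG currency: `T4CurrencyMatching.HistLipschitzBy Real.log Λ γ β`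
with `T4CouplingMatching.FadingMemory C θ Λ`.  The one-sided witness `expFamily B` (`β_{k+1} = B·e^{−k·g_k}`) has such moduli OUTRIGHT — last
coupling only, the constant `B∕e` at every scale (in `u = log g` the section `B·e^{−k e^u}` has derivative `−B·(kg)·e^{−kg}`, and `x·e^{−x} ≤ 1∕e`),
fading at every rate `θ ≥ 0`.  So the no-go of `OneSidedNoGo` §3 survives with ALL of node U2's β-side companions in place:
{one-sided NE4 (`c = 0`), sign + printed-type bound, `LocalAnalyticRel` ∀ `ρ ≤ 1`, log-currency moduli with fading memory} ⊬ NE4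
(`oneSided_not_a_door_log`).  (In the g-currency the witness' last-coupling Lipschitz constant is `B·k`, unbounded in `k` — the phenomenon of
`FadingFromRateRelAnalyticSharp.logCurrency_necessary`; the log currency is the right one here too.)

HONEST FRAMING: a toy family on the tree's HYPOTHESIS SHAPES + one mean-value estimate; nothing of Bałaban's asserted beyond print; NE4 NOT IN
PRINT, NOT PROVED (DEPENDENT); spine PROVED 0∕9 unchanged; one finite T⁴ — NOT continuum on ℝ⁴, NOT infinite volume, NOT a mass gap, NOT Clay.
Reference (TYPES only): [Balaban1987RG1] = T. Bałaban, CMP **109** (1987) 249–301, (0.20) p. 256, §1 p. 264, §5 p. 298.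
-/

noncomputable section

namespace Summit.QuantumFields.BalabanUV.T4Continuum.Spine.NE4

open Set Filter Topology Metric
open Literature.MathematicalPhysics.QuantumFieldTheory.Balaban1983to89
open Literature.MathematicalPhysics.QuantumFieldTheory.Balaban1983to89.FlowStep
open Literature.MathematicalPhysics.QuantumFieldTheory.Balaban1983to89.T4CouplingMatching
open Literature.MathematicalPhysics.QuantumFieldTheory.Balaban1983to89.T4CurrencyMatching (HistLipschitzBy)

/-- THE LOG-CURRENCY MODULI of the witness: last coupling only, the constant `B∕e` at every scale. [folklore] -/
def expModuli (B : ℝ) : ℕ → ℕ → ℝ := fun k i => if i = k then B / Real.exp 1 else 0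

/-- In the variable `u = log g` the section `g ↦ B·e^{−kg}` is `(B∕e)`-Lipschitz UNIFORMLY IN `k`:
`|B·e^{−kp} − B·e^{−kq}| ≤ (B∕e)·|log p − log q|` for `p, q > 0` (`B ≥ 0`; mean value theorem for `u ↦ B·exp(−k·exp u)`, whose derivative
`−B·(k e^u)·e^{−k e^u}` has modulus `≤ B∕e` since `x·e^{−x} ≤ e^{−1}`). [folklore] -/
theorem abs_expSection_sub_le_log {B : ℝ} (hB : 0 ≤ B) (k : ℕ) {p q : ℝ} (hp : 0 < p) (hq : 0 < q) :
    |B * Real.exp (-((k : ℝ) * p)) - B * Real.exp (-((k : ℝ) * q))| ≤ B / Real.exp 1 * |Real.log p - Real.log q| := by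
  set f : ℝ → ℝ := fun u => B * Real.exp (-((k : ℝ) * Real.exp u)) with hf
  have hderiv : ∀ u, HasDerivAt f (B * (Real.exp (-((k : ℝ) * Real.exp u)) * (-((k : ℝ) * Real.exp u)))) u := by
    intro u
    have h1 : HasDerivAt (fun u => -((k : ℝ) * Real.exp u)) (-((k : ℝ) * Real.exp u)) u :=
      ((Real.hasDerivAt_exp u).const_mul (k : ℝ)).neg
    exact (h1.exp).const_mul B
  have hdiff : Differentiable ℝ f := fun u => (hderiv u).differentiableAt
  have hxe : ∀ x : ℝ, x * Real.exp (-x) ≤ Real.exp (-1) := by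
    intro x
    have h1 : x ≤ Real.exp (x - 1) := by have := Real.add_one_le_exp (x - 1); linarith
    calc x * Real.exp (-x) ≤ Real.exp (x - 1) * Real.exp (-x) := mul_le_mul_of_nonneg_right h1 (Real.exp_pos _).le
      _ = Real.exp (-1) := by rw [← Real.exp_add]; ring_nf
  have hbound : ∀ u, ‖deriv f u‖ ≤ B / Real.exp 1 := by
    intro u
    rw [(hderiv u).deriv, Real.norm_eq_abs]
    have hx : 0 ≤ (k : ℝ) * Real.exp u := mul_nonneg (Nat.cast_nonneg k) (Real.exp_pos u).le
    have hcore : Real.exp (-((k : ℝ) * Real.exp u)) * ((k : ℝ) * Real.exp u) ≤ Real.exp (-1) := by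
      rw [mul_comm]; exact hxe _
    have habs : |B * (Real.exp (-((k : ℝ) * Real.exp u)) * (-((k : ℝ) * Real.exp u)))|
        = B * (Real.exp (-((k : ℝ) * Real.exp u)) * ((k : ℝ) * Real.exp u)) := by
      rw [abs_mul, abs_of_nonneg hB, mul_neg, abs_neg, abs_of_nonneg (mul_nonneg (Real.exp_pos _).le hx)]
    rw [habs, div_eq_mul_inv, ← Real.exp_neg]
    exact mul_le_mul_of_nonneg_left hcore hB
  have hmv := Convex.norm_image_sub_le_of_norm_deriv_le (fun u _ => hdiff u) (fun u _ => hbound u) convex_univ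
    (mem_univ (Real.log q)) (mem_univ (Real.log p))
  have ep : f (Real.log p) = B * Real.exp (-((k : ℝ) * p)) := by simp only [hf, Real.exp_log hp]
  have eq' : f (Real.log q) = B * Real.exp (-((k : ℝ) * q)) := by simp only [hf, Real.exp_log hq]
  rw [ep, eq', Real.norm_eq_abs, Real.norm_eq_abs] at hmv
  exact hmv

/-- **THE WITNESS HAS γ-FREE LOG-CURRENCY MODULI** (`B ≥ 0`): `HistLipschitzBy Real.log (expModuli B) γ (expFamily B)` — node U2's (R40)
currency, last coupling only, constant `B∕e` at every scale. [folklore] -/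
theorem histLipschitzLog_expFamily {B : ℝ} (hB : 0 ≤ B) (γ : ℝ) :
    HistLipschitzBy Real.log (expModuli B) γ (expFamily B) := by
  intro k p q hp hq
  have hp' : 0 < p (Fin.last k) := ((mem_box.mp hp) (Fin.last k)).1
  have hq' : 0 < q (Fin.last k) := ((mem_box.mp hq) (Fin.last k)).1
  have hsum : ∑ i : Fin (k + 1), expModuli B k i * |Real.log (p i) - Real.log (q i)|
      = B / Real.exp 1 * |Real.log (p (Fin.last k)) - Real.log (q (Fin.last k))| := by
    rw [Finset.sum_eq_single (Fin.last k)]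
    · simp [expModuli]
    · intro i _ hi
      have : (i : ℕ) ≠ k := fun h => hi (Fin.ext (by simp [h]))
      simp [expModuli, this]
    · simp
  rw [hsum]
  exact abs_expSection_sub_le_log hB k hp' hq'

/-- **… WHICH FADE AT EVERY RATE** (`B ≥ 0`, `θ ≥ 0`): `FadingMemory (B∕e) θ (expModuli B)` — the only non-zero entry has age `0`. [folklore] -/
theorem fadingMemory_expModuli {B θ : ℝ} (hB : 0 ≤ B) (hθ : 0 ≤ θ) : FadingMemory (B / Real.exp 1) θ (expModuli B) := by
  intro k i hik
  by_cases h : i = k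
  · subst h; simp [expModuli, div_nonneg hB (Real.exp_pos 1).le]
  · simp only [expModuli, h, if_false]
    exact ⟨le_rfl, mul_nonneg (div_nonneg hB (Real.exp_pos 1).le) (pow_nonneg hθ _)⟩

/-- **SUMMARY (R41b) — THE NO-GO WITH ALL OF NODE U2's COMPANIONS IN PLACE**: for `B > 0`, `γ > 0`, `0 ≤ θ < 1`, `ρ ≤ 1` and every `c`,
the witness is monotone along the scales, carries the sign and the printed-type bound, node U2's relative charts, log-currency history moduli
fading at rate `θ` — and violates `ScaleShiftRate c θ γ`.  One-sidedness is not a door even granted every companion. [folklore] -/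
theorem oneSided_not_a_door_log {B γ θ ρ : ℝ} (hB : 0 < B) (hγ : 0 < γ) (hθ0 : 0 ≤ θ) (hθ1 : θ < 1) (hρ1 : ρ ≤ 1) (c : ℝ) :
    MonotoneAlongScales γ (expFamily B) ∧ (BetaLowerH 0 γ (expFamily B) ∧ BetaUpperH B γ (expFamily B)) ∧
      LocalAnalyticRel B γ ρ (expFamily B) ∧
      (HistLipschitzBy Real.log (expModuli B) γ (expFamily B) ∧ FadingMemory (B / Real.exp 1) θ (expModuli B)) ∧
      ¬ ScaleShiftRate c θ γ (expFamily B) :=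
  ⟨monotone_expFamily hB.le γ, betaLowerH_betaUpperH_expFamily hB γ, localAnalyticRel_expFamily hB.le hρ1,
    ⟨histLipschitzLog_expFamily hB.le γ, fadingMemory_expModuli hB.le hθ0⟩, not_scaleShiftRate_expFamily hB hγ hθ0 hθ1 c⟩

/-! ## §2 (v1.1 append, generation 8) Not even a SUMMABLE envelope — node U6's weakest currency (census (R9)) fails too

Pure addition; the v1 declarations above are byte-unchanged. -/

/-- **NO SUMMABLE ENVELOPE** (`B > 0`, `γ > 0`): there is NO summable `σ : ℕ → ℝ` dominating the witness' two-sided scale shift on the boxes,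
`|expFamily B (k+1) w − expFamily B k (tail w)| ≤ σ k` — from `k ≥ max 1 ⌈1∕γ⌉` on the harmonic lower bound `B∕(2e·k) ≤ σ k` (`harmonic_lower_expFamily`)
holds, and the harmonic series diverges (`Real.not_summable_natCast_inv`).  So the one-sided ∕ monotone weakening of NE4 fails not only the geometric
`ScaleShiftRate` but also the summable-envelope currency that is all node U6 needs (census (R9), `T4CurrencyMatching` ∕ `T4FlagMemoryPolyWeight`). [folklore] -/
theorem no_summable_envelope_expFamily {B γ : ℝ} (hB : 0 < B) (hγ : 0 < γ) :
    ¬ ∃ σ : ℕ → ℝ, Summable σ ∧ ∀ k (w : Fin (k + 2) → ℝ), w ∈ Box γ (k + 1) →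
      |expFamily B (k + 1) w - expFamily B k (Fin.tail w)| ≤ σ k := by
  rintro ⟨σ, hσ, hdom⟩
  set k₁ : ℕ := max 1 ⌈1 / γ⌉₊ with hk₁
  set a : ℝ := B / (2 * Real.exp 1) with ha
  have ha0 : 0 < a := by rw [ha]; positivity
  -- the shifted harmonic minorant
  have hlow : ∀ n : ℕ, a * ((n + k₁ : ℕ) : ℝ)⁻¹ ≤ σ (n + k₁) := by
    intro n
    have hk : 1 ≤ n + k₁ := le_trans (le_max_left _ _) (Nat.le_add_left _ _)
    have hk0 : (0 : ℝ) < ((n + k₁ : ℕ) : ℝ) := by exact_mod_cast hk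
    have hkγ : 1 / ((n + k₁ : ℕ) : ℝ) ≤ γ := by
      have h1 : (⌈1 / γ⌉₊ : ℝ) ≤ ((n + k₁ : ℕ) : ℝ) := by
        exact_mod_cast le_trans (le_max_right 1 _) (Nat.le_add_left _ _)
      have h2 : 1 / γ ≤ ((n + k₁ : ℕ) : ℝ) := (Nat.le_ceil _).trans h1
      rw [div_le_iff₀ hk0]
      calc (1 : ℝ) = 1 / γ * γ := by field_simp
        _ ≤ ((n + k₁ : ℕ) : ℝ) * γ := mul_le_mul_of_nonneg_right h2 hγ.le
        _ = γ * ((n + k₁ : ℕ) : ℝ) := mul_comm _ _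
    obtain ⟨w, hw, hle⟩ := harmonic_lower_expFamily (γ := γ) hB.le hk hkγ
    have h3 := hle.trans (hdom _ w hw)
    have h4 : a * ((n + k₁ : ℕ) : ℝ)⁻¹ = B / (2 * Real.exp 1 * ((n + k₁ : ℕ) : ℝ)) := by
      rw [ha]; field_simp
    rw [h4]; exact h3
  -- comparison: the shifted harmonic minorant would be summable
  have hσ' : Summable (fun n : ℕ => σ (n + k₁)) := (summable_nat_add_iff k₁).mpr hσ
  have hmin : Summable (fun n : ℕ => a * ((n + k₁ : ℕ) : ℝ)⁻¹) :=
    Summable.of_nonneg_of_le (fun n => mul_nonneg ha0.le (inv_nonneg.mpr (Nat.cast_nonneg _))) hlow hσ'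
  have hharm : Summable (fun m : ℕ => a * (m : ℝ)⁻¹) :=
    (summable_nat_add_iff k₁ (f := fun m : ℕ => a * (m : ℝ)⁻¹)).mp hmin
  exact Real.not_summable_natCast_inv ((summable_mul_left_iff ha0.ne').mp hharm)

/-- **SUMMARY (R41c)**: the witness meets one-sided NE4 with `c = 0` and every β-side companion of node U2, and its two-sided scale shift admits NO summable
envelope — the (R9) currency included. [folklore] -/
theorem oneSided_not_a_door_summable {B γ : ℝ} (hB : 0 < B) (hγ : 0 < γ) :
    MonotoneAlongScales γ (expFamily B) ∧
      ¬ ∃ σ : ℕ → ℝ, Summable σ ∧ ∀ k (w : Fin (k + 2) → ℝ), w ∈ Box γ (k + 1) →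
        |expFamily B (k + 1) w - expFamily B k (Fin.tail w)| ≤ σ k :=
  ⟨monotone_expFamily hB.le γ, no_summable_envelope_expFamily hB hγ⟩

end Summit.QuantumFields.BalabanUV.T4Continuum.Spine.NE4

end
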